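import Literature.Topology.FourManifolds.DiscAttachmentChart
import Literature.Topology.FourManifolds.IntersectionLatticeProofs
import Literature.Topology.FourManifolds.GluingProofs
import HarnessLib

/-!
# Attaching a disc to a null-cobordism of the sphere, II: `M₀ ∪ cone(bM₀) ≃ₜ M₀ ∪ Dⁿ⁺¹`

Topic `Literature/Topology/FourManifolds`; continuation of `DiscAttachmentChart.lean` (the cap
chart `e : ℝⁿ⁺¹ → X` of `X = M₀ ∪_{𝕊ⁿ} 𝔻ⁿ⁺¹`, an open embedding with `e(𝔻ⁿ⁺¹) = jB(𝔻ⁿ⁺¹)`).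
Kervaire–Milnor, *Groups of homotopy spheres: I*, Ann. of Math. (2) 77 (1963), compute the
signature `σ(M₀)` of an s-parallelizable `M₀` bounded by the `(4m-1)`-sphere (p. 529) on the
"closed homology manifold with the same signature" `M₀ ∪ cone(bM₀)` (footnote pp. 528–529) — the
tree's `Literature.Topology.FourManifolds.ClosedModel n M₀`, the one-point compactification of
the interior, on which `HomologicalOrientation.signatureInDim` is evaluated in
`HomotopySphere.signatureSet` — and pass to and from closed manifolds by removing or attaching a
disc (proof of Lemma 7.4, p. 529; Kosinski, *Differential Manifolds* (1993), proof of IX.8.7: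
"Attaching a disc to the boundary of `M₁` produces a closed manifold `M`"). This file PROVES
(no definitions, no named facts):

* `ClosedModel.isQuotientMap_boundaryCollapse`, `ClosedModel.exists_homeomorph_of_collapse` —
  **recognition of the closed model**: a continuous map `f : W → Y` from a compact manifold with
  nonempty boundary to a Hausdorff space, sending `∂W` to a point `y₀` and the interior
  bijectively onto `Y ∖ {y₀}`, induces `W ∪ cone(∂W) ≃ₜ Y`, `∞ ↦ y₀` (Hatcher 2002, Prop. 2.22,
  `W/∂W`; the argument of `ClosedMinusBall.closedModelHomeomorph`, made reusable);
* `ClosedModel.signatureInDim_comap_symm` — for `Φ : W ∪ cone(∂W) ≃ₜ X` and any orientation `μ'`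
  of the closed model, `σ(X, μ'.comap Φ⁻¹) = σ(W, μ')` (homeomorphism invariance of the
  signature, the tree's `signature_intersectionForm_comap_holds`; Gompf–Stipsicz §1.2);
* `NullCobordism.exists_homeomorph_closedModel_of_boundaryGluingData`,
  `NullCobordism.nonempty_homeomorph_closedModel_of_isBoundaryGluing` — **`M₀ ∪ cone(bM₀) ≃ₜ X`**
  for every smooth `X` which is the gluing `M₀ ∪_{id} 𝔻ⁿ⁺¹` (`IsBoundaryGluing c.boundaryData
  (closedBallBoundaryData n) id`), `∞ ↦` the centre of the disc: collapse the chart ball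
  `e(𝔻ⁿ⁺¹) = jB(𝔻ⁿ⁺¹)` to its centre (`discCollapse`, `DiscRemovalClosedModel.lean`) after `jA`;
* `NullCobordism.exists_signatureInDim_eq_of_isBoundaryGluing`,
  `NullCobordism.exists_closed_signatureInDim_eq` — hence, for `n + 1 = k + k`, **every signature
  `σ(M₀, μ')` is the signature `σ(X, μ)` of the closed smooth `(n+1)`-manifold
  `X = M₀ ∪_{𝕊ⁿ} 𝔻ⁿ⁺¹`** (which exists: `exists_isBoundaryGluing_holds`, Bröcker–Jänich (13.11))
  for a suitable orientation `μ` of `X`.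

Consumer: `HomotopySpheresSigmaTwoDivides.lean` (Kervaire–Milnor's `224 ∣ σ(M₀)`, `bM₀ = S⁷`,
from the closed-manifold theorem of Milnor–Kervaire 1958 / Kosinski IX.8.7).

## References

* M. A. Kervaire, J. W. Milnor, *Groups of homotopy spheres: I*, Ann. of Math. (2) 77 (1963),
  504–537: §7, p. 529 (the manifolds `M₀`; proof of Lemma 7.4), footnote pp. 528–529.
  [KervaireMilnorAnnals1963]
* A. Kosinski, *Differential Manifolds*, Academic Press (1993), IX.8.7, last paragraph of the
  proof. [Kosinski1993]
* A. Hatcher, *Algebraic Topology*, CUP (2002), Prop. 2.22 and §3.3. [Hatcher2002]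
* R. Gompf, A. Stipsicz, *4-Manifolds and Kirby Calculus*, AMS GSM 20 (1999), §1.2 (invariance of
  the intersection form). [GompfStipsiczGSM1999]
-/

open scoped Manifold ContDiff Topology
open Set Function Metric Topology

noncomputable section

universe u

namespace Literature.Topology.FourManifolds

open Literature.AlgebraicTopology.SingularHomology (HomologicalOrientation)

/-! ### Recognising the closed model -/

namespace ClosedModel

variable {n : ℕ} {W : Type u} [TopologicalSpace W] [T2Space W] [CompactSpace W]
  [ChartedSpace (EuclideanHalfSpace (n + 1)) W] [IsManifold (𝓡∂ (n + 1)) ∞ W]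
  {Y : Type*} [TopologicalSpace Y] [T2Space Y]

/-- The boundary collapse `W → W ∪ cone(∂W)` is a quotient map when `∂W ≠ ∅` (a continuous closed
surjection from a compact space onto a Hausdorff space). [folklore] -/
theorem isQuotientMap_boundaryCollapse (hne : ((𝓡∂ (n + 1)).boundary W).Nonempty) :
    IsQuotientMap (boundaryCollapse n W) := by
  refine ((boundaryCollapse n W).continuous.isClosedMap).isQuotientMap
    (boundaryCollapse n W).continuous ?_
  rintro (_ | x)
  · obtain ⟨w, hw⟩ := hne
    exact ⟨w, boundaryCollapse_of_mem_boundary hw⟩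
  · exact ⟨x.1, boundaryCollapse_of_mem_interior x.2⟩

/-- **Recognition of the closed model.** Let `W` be a compact manifold with nonempty boundary and
`f : W → Y` a continuous map to a Hausdorff space which sends `∂W` to a point `y₀` and the interior
injectively onto `Y ∖ {y₀}`. Then `f` induces a homeomorphism `W ∪ cone(∂W) ≃ₜ Y`, `∞ ↦ y₀`: the
induced map on `W/∂W` is a continuous (the collapse is a quotient map) bijection from a compact
space onto a Hausdorff space (Hatcher 2002, Prop. 2.22 and Ch. 0, `q : (W, ∂W) → (W/∂W, pt)`; the
argument of `ClosedMinusBall.closedModelHomeomorph`). [folklore] -/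
theorem exists_homeomorph_of_collapse (f : W → Y) (hf : Continuous f) (y₀ : Y)
    (hne : ((𝓡∂ (n + 1)).boundary W).Nonempty)
    (hb : ∀ w ∈ (𝓡∂ (n + 1)).boundary W, f w = y₀)
    (hmaps : MapsTo f ((𝓡∂ (n + 1)).interior W) {y₀}ᶜ)
    (hinj : InjOn f ((𝓡∂ (n + 1)).interior W))
    (hsurj : SurjOn f ((𝓡∂ (n + 1)).interior W) {y₀}ᶜ) :
    ∃ Φ : ClosedModel n W ≃ₜ Y,
      Φ ClosedModel.infty = y₀ ∧ ∀ w, Φ (boundaryCollapse n W w) = f w := by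
  let F : ClosedModel n W → Y := fun q => Option.elim q y₀ fun x => f x.1
  have hF : ∀ w, F (boundaryCollapse n W w) = f w := by
    intro w
    by_cases hw : w ∈ (𝓡∂ (n + 1)).interior W
    · rw [boundaryCollapse_of_mem_interior hw]
      rfl
    · rw [boundaryCollapse_apply, boundaryCollapseFun_of_not_mem hw]
      exact (hb w (by rwa [← ModelWithCorners.compl_interior])).symm
  have hFc : Continuous F := by
    rw [(isQuotientMap_boundaryCollapse hne).continuous_iff]
    have : F ∘ boundaryCollapse n W = f := funext hF
    rw [this]
    exact hf
  have hFb : Bijective F := by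
    constructor
    · rintro (_ | x) (_ | x') h
      · rfl
      · exact absurd h.symm (hmaps x'.2)
      · exact absurd h (hmaps x.2)
      · exact congrArg some (Subtype.ext (hinj x.2 x'.2 h))
    · intro y
      by_cases hy : y = y₀
      · exact ⟨none, hy.symm⟩
      · obtain ⟨w, hw, rfl⟩ := hsurj hy
        exact ⟨some ⟨w, hw⟩, rfl⟩
  exact ⟨Continuous.homeoOfEquivCompactToT2 (f := Equiv.ofBijective F hFb) hFc, rfl, hF⟩

/-- **Homeomorphism invariance of the signature of the closed model**: for `Φ : W ∪ cone(∂W) ≃ₜ X`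
and the transported orientation `μ'.comap Φ⁻¹` of `X`, `σ(X, μ'.comap Φ⁻¹) = σ(W, μ')` (the
tree's `signature_intersectionForm_comap_holds`; Gompf–Stipsicz §1.2, Milnor–Husemoller §V.1).
[folklore] -/
theorem signatureInDim_comap_symm {X : Type u} [TopologicalSpace X]
    [ChartedSpace (EuclideanSpace ℝ (Fin (n + 1))) X] (Φ : ClosedModel n W ≃ₜ X) {k : ℕ}
    (h : k + k = n + 1) (μ' : HomologicalOrientation ℤ (ClosedModel n W) (n + 1)) :
    (μ'.comap Φ.symm).signatureInDim h = μ'.signatureInDim h := by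
  -- `signature_intersectionForm_comap` carries a (mathematically idle) atlas on its source:
  -- transport the atlas of `X` along `Φ`.
  letI : ChartedSpace X (ClosedModel n W) :=
    Φ.toOpenPartialHomeomorph.singletonChartedSpace (by simp)
  letI : ChartedSpace (EuclideanSpace ℝ (Fin (n + 1))) (ClosedModel n W) :=
    ChartedSpace.comp (EuclideanSpace ℝ (Fin (n + 1))) X _
  rw [HomologicalOrientation.signatureInDim_def, HomologicalOrientation.signatureInDim_def]
  exact signature_intersectionForm_comap_holds (X := ClosedModel n W) (Y := X) h μ' Φ.symm

end ClosedModel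

/-! ### The closed model of a null-cobordism of the sphere is `M₀ ∪_{𝕊ⁿ} 𝔻ⁿ⁺¹` -/

namespace NullCobordism

variable {n : ℕ} (c : NullCobordism n (sphere (0 : EuclideanSpace ℝ (Fin (n + 1))) 1))
  {X : Type*} [TopologicalSpace X] [T2Space X]
  [ChartedSpace (EuclideanSpace ℝ (Fin (n + 1))) X] [IsManifold (𝓡 (n + 1)) ∞ X]
  (G : BoundaryGluingData c.boundaryData (closedBallBoundaryData n)
    (Equiv.refl (sphere (0 : EuclideanSpace ℝ (Fin (n + 1))) 1)) X)

/-- The boundary of a null-cobordism of the sphere is nonempty. [folklore] -/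
theorem boundary_nonempty_sphere : ((𝓡∂ (n + 1)).boundary c.W).Nonempty :=
  ⟨c.incl ⟨EuclideanSpace.single 0 1, by simp⟩, c.incl_mem_boundary _⟩

/-- **`M₀ ∪ cone(bM₀) ≃ₜ M₀ ∪_{𝕊ⁿ} 𝔻ⁿ⁺¹`.** For a null-cobordism `M₀ = c.W` of the standard sphere
and gluing data exhibiting the smooth manifold `X` as `M₀ ∪_{id} 𝔻ⁿ⁺¹`, the closed model
`M₀ ∪ cone(bM₀)` (one-point compactification of the interior, on which `σ(M₀)` is computed) is
homeomorphic to `X`, the cone point going to the centre of the disc: collapse the closed disc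
`jB(𝔻ⁿ⁺¹) = e(𝔻ⁿ⁺¹)` of `X` to its centre along the cap chart `e` (`discCollapse`), precompose
with `jA`, and recognise the closed model (`ClosedModel.exists_homeomorph_of_collapse`).
Kervaire–Milnor 1963, footnote pp. 528–529 with the proof of Lemma 7.4 (p. 529); Kosinski 1993,
proof of IX.8.7 ("Attaching a disc to the boundary of `M₁` produces a closed manifold `M`").
[cite: KervaireMilnorAnnals1963, §7, footnote pp. 528–529 and proof of Lemma 7.4 (p. 529)] -/
theorem exists_homeomorph_closedModel_of_boundaryGluingData :
    ∃ Φ : ClosedModel n c.W ≃ₜ X,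
      Φ ClosedModel.infty = G.jB ⟨0, mem_closedBall_self zero_le_one⟩ := by
  haveI : Nonempty c.boundaryData.carrier :=
    ⟨(⟨EuclideanSpace.single 0 1, by simp⟩ : sphere (0 : EuclideanSpace ℝ (Fin (n + 1))) 1)⟩
  obtain ⟨C⟩ := c.boundaryData.nonempty_openCollar
  obtain ⟨e, h₁, h₂⟩ := c.exists_capChart G C
  have he := c.isOpenEmbedding_of_capChart G C h₁ h₂
  have hB := c.image_closedBall_of_capChart G h₁
  have hint : ∀ w ∈ (𝓡∂ (n + 1)).interior c.W,
      G.jA w ∈ (e '' Metric.closedBall (0 : EuclideanSpace ℝ (Fin (n + 1))) 1)ᶜ := by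
    intro w hw hmem
    rw [hB] at hmem
    obtain ⟨b, hb⟩ := hmem
    obtain ⟨z, rfl, -⟩ := (c.cap_jA_eq_jB_iff G _ _).1 hb.symm
    have := c.incl_mem_boundary z
    rw [← ModelWithCorners.compl_interior] at this
    exact this hw
  obtain ⟨Φ, hΦ, -⟩ := ClosedModel.exists_homeomorph_of_collapse (discCollapse e ∘ G.jA)
    ((continuous_discCollapse he).comp G.continuous_jA) (e 0) c.boundary_nonempty_sphere
    (fun w hw => by
      rw [← c.range_incl] at hw
      obtain ⟨z, rfl⟩ := hw
      refine (discCollapse_eq_center_iff he).2 ?_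
      rw [hB]
      exact ⟨_, (c.cap_jA_incl G z).symm⟩)
    (fun w hw => discCollapse_mapsTo he (hint w hw))
    (fun w hw w' hw' heq => G.injective_jA (discCollapse_injOn he (hint w hw) (hint w' hw') heq))
    (fun y hy => by
      obtain ⟨x, hx, rfl⟩ := discCollapse_surjOn he hy
      rw [hB, ← G.image_jA_interior_eq_compl] at hx
      obtain ⟨w, hw, rfl⟩ := hx
      exact ⟨w, hw, rfl⟩)
  exact ⟨Φ, hΦ.trans (c.capChart_zero G h₁)⟩

omit [T2Space X] in
/-- **`M₀ ∪ cone(bM₀) ≃ₜ M₀ ∪_{𝕊ⁿ} 𝔻ⁿ⁺¹`**, for the relational predicate: any smooth manifold `X`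
which is the gluing of `M₀ = c.W` and `𝔻ⁿ⁺¹` along the identity of `𝕊ⁿ`
(`IsBoundaryGluing c.boundaryData (closedBallBoundaryData n) id`) is homeomorphic to the closed
model of `M₀` (`X` is Hausdorff by `BoundaryGluingData.t2Space`). Kervaire–Milnor 1963, proof of
Lemma 7.4 with the footnote pp. 528–529.
[cite: KervaireMilnorAnnals1963, §7, proof of Lemma 7.4 (p. 529)] -/
theorem nonempty_homeomorph_closedModel_of_isBoundaryGluing
    (hX : IsBoundaryGluing c.boundaryData (closedBallBoundaryData n) id (𝓡 (n + 1)) X) :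
    Nonempty (ClosedModel n c.W ≃ₜ X) := by
  obtain ⟨G⟩ : Nonempty (BoundaryGluingData c.boundaryData (closedBallBoundaryData n)
      (Equiv.refl (sphere (0 : EuclideanSpace ℝ (Fin (n + 1))) 1)) X) :=
    hX.nonempty_boundaryGluingData
  haveI := G.t2Space
  obtain ⟨Φ, -⟩ := c.exists_homeomorph_closedModel_of_boundaryGluingData G
  exact ⟨Φ⟩

end NullCobordism

/-! ### Signatures: `σ(M₀) = σ(M₀ ∪_{𝕊ⁿ} 𝔻ⁿ⁺¹)` -/

namespace NullCobordism

variable {n : ℕ} (c : NullCobordism n (sphere (0 : EuclideanSpace ℝ (Fin (n + 1))) 1))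

/-- **`σ(M₀)` is the signature of the closed manifold `M₀ ∪_{𝕊ⁿ} 𝔻ⁿ⁺¹`.** For `n + 1 = k + k`, a
null-cobordism `M₀ = c.W` of the standard sphere, any smooth `X = M₀ ∪_{id} 𝔻ⁿ⁺¹` and any
orientation `μ'` of the closed model `M₀ ∪ cone(bM₀)`, there is an orientation `μ` of `X` with
`σ(X, μ) = σ(M₀, μ')` (transport along `M₀ ∪ cone(bM₀) ≃ₜ X`; homeomorphism invariance of the
signature). Kervaire–Milnor 1963, footnote pp. 528–529 ("a closed homology manifold with the same
signature") and proof of Lemma 7.4.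
[cite: KervaireMilnorAnnals1963, §7, footnote pp. 528–529 and proof of Lemma 7.4 (p. 529)] -/
theorem exists_signatureInDim_eq_of_isBoundaryGluing {X : Type} [TopologicalSpace X]
    [ChartedSpace (EuclideanSpace ℝ (Fin (n + 1))) X] [IsManifold (𝓡 (n + 1)) ∞ X]
    (hX : IsBoundaryGluing c.boundaryData (closedBallBoundaryData n) id (𝓡 (n + 1)) X)
    {k : ℕ} (h : k + k = n + 1) (μ' : HomologicalOrientation ℤ (ClosedModel n c.W) (n + 1)) :
    ∃ μ : HomologicalOrientation ℤ X (n + 1), μ.signatureInDim h = μ'.signatureInDim h := by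
  obtain ⟨Φ⟩ := c.nonempty_homeomorph_closedModel_of_isBoundaryGluing hX
  exact ⟨μ'.comap Φ.symm, ClosedModel.signatureInDim_comap_symm Φ h μ'⟩

/-- **Every `σ(M₀)` is the signature of a closed smooth manifold `M₀ ∪_{𝕊ⁿ} 𝔻ⁿ⁺¹**: the gluing
exists (`exists_isBoundaryGluing_holds`, Bröcker–Jänich (13.11)) and carries an orientation with
the same signature (`exists_signatureInDim_eq_of_isBoundaryGluing`). Kosinski 1993, proof of
IX.8.7: "Attaching a disc to the boundary of `M₁` produces a closed manifold `M`"; Kervaire–Milnor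
1963, proof of Lemma 7.4. [cite: Kosinski1993, IX.8.7 (last paragraph of the proof)] -/
theorem exists_closed_signatureInDim_eq {k : ℕ} (h : k + k = n + 1)
    (μ' : HomologicalOrientation ℤ (ClosedModel n c.W) (n + 1)) :
    ∃ (X : Type) (_ : TopologicalSpace X) (_ : T2Space X) (_ : SecondCountableTopology X)
      (_ : CompactSpace X) (_ : ChartedSpace (EuclideanSpace ℝ (Fin (n + 1))) X)
      (_ : IsManifold (𝓡 (n + 1)) ∞ X),
      IsBoundaryGluing c.boundaryData (closedBallBoundaryData n) id (𝓡 (n + 1)) X ∧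
        ∃ μ : HomologicalOrientation ℤ X (n + 1), μ.signatureInDim h = μ'.signatureInDim h := by
  obtain ⟨X, _, _, _, _, _, _, hX⟩ := exists_isBoundaryGluing_holds c.boundaryData
    (closedBallBoundaryData n)
    (Diffeomorph.refl (𝓡 n) (sphere (0 : EuclideanSpace ℝ (Fin (n + 1))) 1) ∞)
  exact ⟨X, _, ‹_›, ‹_›, ‹_›, _, ‹_›, hX, c.exists_signatureInDim_eq_of_isBoundaryGluing hX h μ'⟩

end NullCobordism

end Literature.Topology.FourManifolds
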